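import Literature.Combinatorics.SimpleGraph.MatchingMinorProjection
import HarnessLib

/-!
# The perfect-matching polynomial and Valiant projections, II: bicontraction

Topic `Combinatorics/SimpleGraph`; sequel to `MatchingMinorProjection.lean` (definition item
`defn-IsMatchingMinor`, wanted API (i)).

**Bicontracting a vertex of degree two makes `PM` a projection.** In normal position
(`MatchingMinor.bicontractRowZero`: the row vertex `0` of `G ⊆ K_{m+2,m+2}` has exactly the two
neighbours column `0` and column `1`; delete row `0`, merge the columns `0, 1` into the new column
`0`, shift indices down), the perfect matchings of the bicontraction `G'` correspond to those of `G`
*after deleting the edges from column `1` to the common neighbours of columns `0` and `1`* (a row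
`i ≠ 0` adjacent to both would otherwise be counted twice). Hence `PM_{G'} = PM_G (x_{00},
x_{01} ↦ 1; x_{i1} ↦ 0 for common neighbours i; x_{ij} ↦ x_{i-1, shiftDown j} otherwise)`
(`aeval_bicontractSubst_perfectMatchingPoly`), a substitution of variables and constants, so
`PM_{G'}` is a Valiant projection of `PM_G` (`isProjection_perfectMatchingPoly_bicontractRowZero`).
The proof is the Laplace expansion of the permanent along row `0` (two surviving terms) followed by
additivity of the permanent in the merged column.

## References

* N. Robertson, P. D. Seymour, R. Thomas, *Permanents, Pfaffian orientations, and even directed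
  circuits*, Ann. of Math. 150 (1999) 929–975, §4 (bicontraction). [RobertsonSeymourThomas1999]
* L. G. Valiant, *Completeness classes in algebra*, STOC 1979 (projections). [Valiant1979]
-/

namespace Literature.Combinatorics.SimpleGraph

open MvPolynomial Equiv Finset Matrix

section Bicontraction

variable {k : Type*} [CommSemiring k] {m : ℕ}

/-! ### Index bookkeeping for `shiftDown` and `bicontractRowZero` -/

/-- `shiftDown` undoes `Fin.succ`. [folklore] -/
@[simp] theorem shiftDown_succ (x : Fin (m + 1)) : shiftDown x.succ = x := by
  ext; simp [shiftDown, Fin.val_succ]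

/-- `shiftDown 0 = 0`. [folklore] -/
@[simp] theorem shiftDown_zero : shiftDown (0 : Fin (m + 2)) = 0 := by
  ext; simp [shiftDown]

/-- `shiftDown 1 = 0` (the columns `0` and `1` are merged). [folklore] -/
@[simp] theorem shiftDown_one : shiftDown (1 : Fin (m + 2)) = 0 := by
  ext; simp [shiftDown]

/-- `x.succ = 1 ↔ x = 0` in `Fin (m + 2)`. [folklore] -/
theorem succ_eq_one_iff (x : Fin (m + 1)) : (x.succ : Fin (m + 2)) = 1 ↔ x = 0 := by
  rw [← Fin.succ_zero_eq_one, Fin.succ_inj]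

/-- **Edges of the bicontraction.** `(i', j')` is an edge of `bicontractRowZero G` iff
`(i'+1, j'+1)` is an edge of `G`, or `j' = 0` (the merged column) and `(i'+1, 0)` is an edge of
`G`. [folklore] -/
theorem mem_bicontractRowZero_iff (G : Finset (Fin (m + 2) × Fin (m + 2)))
    (i' j' : Fin (m + 1)) :
    (i', j') ∈ bicontractRowZero G ↔
      (i'.succ, j'.succ) ∈ G ∨ (j' = 0 ∧ (i'.succ, (0 : Fin (m + 2))) ∈ G) := by
  simp only [bicontractRowZero, Finset.mem_image, Finset.mem_filter, Prod.exists, Prod.mk.injEq]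
  constructor
  · rintro ⟨i, j, ⟨hG, hi0⟩, hi, hj⟩
    have hi' : i = i'.succ := by
      ext
      have h1 := congrArg Fin.val hi
      simp only [shiftDown] at h1
      have h2 : i.val ≠ 0 := fun h => hi0 (Fin.ext h)
      simp only [Fin.val_succ]
      omega
    subst hi'
    by_cases hj0 : j.val = 0
    · have hjz : j = 0 := Fin.ext hj0
      subst hjz
      right
      refine ⟨?_, hG⟩
      rw [← hj]; exact shiftDown_zero
    · left
      have hj' : j = j'.succ := by
        ext
        have h1 := congrArg Fin.val hj
        simp only [shiftDown] at h1
        simp only [Fin.val_succ]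
        omega
      subst hj'
      exact hG
  · rintro (h | ⟨rfl, h⟩)
    · exact ⟨i'.succ, j'.succ, ⟨h, Fin.succ_ne_zero _⟩, shiftDown_succ _, shiftDown_succ _⟩
    · exact ⟨i'.succ, 0, ⟨h, Fin.succ_ne_zero _⟩, shiftDown_succ _, shiftDown_zero⟩

/-- Row `0` of a `RowZeroBicontractible` graph: `(0, j)` is an edge iff `j ∈ {0, 1}`.
[folklore] -/
theorem RowZeroBicontractible.zero_mem_iff {G : Finset (Fin (m + 2) × Fin (m + 2))}
    (hG : RowZeroBicontractible G) (j : Fin (m + 2)) :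
    ((0 : Fin (m + 2)), j) ∈ G ↔ j = 0 ∨ j = 1 := by
  have h := Finset.ext_iff.1 hG (0, j)
  simpa [Finset.mem_filter] using h

/-! ### The bicontraction substitution -/

/-- The **bicontraction substitution** on the edge variables of `G ⊆ K_{m+2,m+2}` (normal
position): the two edges at the row vertex `0` become `1`; an edge `(i, 1)` from the column `1` to
a *common* neighbour `i` of the columns `0, 1` becomes `0` (deleted first, so that no perfect
matching of the bicontraction is counted twice); every other variable `x_{ij}` becomes the variable
`x_{i-1, shiftDown j}` of the bicontracted graph (columns `0, 1 ↦ 0`). [folklore] -/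
noncomputable def bicontractSubst (G : Finset (Fin (m + 2) × Fin (m + 2))) :
    Fin (m + 2) × Fin (m + 2) → MvPolynomial (Fin (m + 1) × Fin (m + 1)) k :=
  fun e => if e.1 = 0 then 1
    else if e.2 = 1 ∧ (e.1, (0 : Fin (m + 2))) ∈ G then 0
    else MvPolynomial.X (shiftDown e.1, shiftDown e.2)

/-- Each value of the bicontraction substitution is a variable or a constant. [folklore] -/
theorem bicontractSubst_isVarOrConst (G : Finset (Fin (m + 2) × Fin (m + 2)))
    (e : Fin (m + 2) × Fin (m + 2)) :
    (∃ e', bicontractSubst (k := k) G e = MvPolynomial.X e') ∨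
      ∃ c, bicontractSubst (k := k) G e = MvPolynomial.C c := by
  unfold bicontractSubst
  split_ifs
  · exact Or.inr ⟨1, by simp⟩
  · exact Or.inr ⟨0, by simp⟩
  · exact Or.inl ⟨_, rfl⟩

/-- **Bicontraction is a substitution.** For `G ⊆ K_{m+2,m+2}` in normal position (row `0` of
degree two with neighbours the columns `0, 1`),
`PM_{bicontractRowZero G} = PM_G (bicontractSubst G)`.
Proof: expand `per` of the substituted matrix along row `0` (entries `1, 1, 0, …, 0`); the two
minors are the biadjacency matrix of the bicontraction with its merged column `0` replaced by the
column-`1` part (common neighbours removed), resp. the column-`0` part, of that column; conclude by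
additivity of the permanent in column `0`. [folklore] -/
theorem aeval_bicontractSubst_perfectMatchingPoly {G : Finset (Fin (m + 2) × Fin (m + 2))}
    (hG : RowZeroBicontractible G) :
    aeval (bicontractSubst (k := k) G) (perfectMatchingPoly G k) =
      perfectMatchingPoly (bicontractRowZero G) k := by
  rw [aeval_perfectMatchingPoly]
  set A : Matrix (Fin (m + 2)) (Fin (m + 2)) (MvPolynomial (Fin (m + 1) × Fin (m + 1)) k) :=
    Matrix.of fun i j => if (i, j) ∈ G then bicontractSubst (k := k) G (i, j) else 0 with hA
  -- the biadjacency matrix of the bicontraction and the two pieces of its column `0`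
  set N : Matrix (Fin (m + 1)) (Fin (m + 1)) (MvPolynomial (Fin (m + 1) × Fin (m + 1)) k) :=
    Matrix.of fun i j => if (i, j) ∈ bicontractRowZero G then MvPolynomial.X (i, j) else 0 with hN
  let u : Fin (m + 1) → MvPolynomial (Fin (m + 1) × Fin (m + 1)) k := fun i' =>
    if (i'.succ, (1 : Fin (m + 2))) ∈ G ∧ (i'.succ, (0 : Fin (m + 2))) ∉ G then
      MvPolynomial.X (i', 0) else 0
  let v : Fin (m + 1) → MvPolynomial (Fin (m + 1) × Fin (m + 1)) k := fun i' =>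
    if (i'.succ, (0 : Fin (m + 2))) ∈ G then MvPolynomial.X (i', 0) else 0
  -- row 0 of A
  have hrow : ∀ j : Fin (m + 2), A 0 j = if j = 0 ∨ j = 1 then 1 else 0 := by
    intro j
    simp only [hA, of_apply, hG.zero_mem_iff, bicontractSubst]
    split_ifs <;> rfl
  -- the two minors
  have h1 : A.submatrix Fin.succ (Fin.succAbove 0) = N.updateCol 0 u := by
    ext i' j'
    simp only [submatrix_apply, Fin.zero_succAbove, updateCol_apply, hA, hN, of_apply,
      bicontractSubst, Fin.succ_ne_zero, if_false, succ_eq_one_iff, shiftDown_succ,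
      mem_bicontractRowZero_iff]
    by_cases hj : j' = 0
    · subst hj
      simp only [Fin.succ_zero_eq_one, true_and, if_true, u]
      by_cases hP : (i'.succ, (1 : Fin (m + 2))) ∈ G <;>
        by_cases hQ : (i'.succ, (0 : Fin (m + 2))) ∈ G <;> simp [hP, hQ]
    · simp [hj]
  have h2 : A.submatrix Fin.succ (Fin.succAbove 1) = N.updateCol 0 v := by
    ext i' j'
    rcases Fin.eq_zero_or_eq_succ j' with rfl | ⟨x, rfl⟩
    · simp only [submatrix_apply, Fin.succAbove_ne_zero_zero (one_ne_zero), updateCol_apply,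
        if_true, hA, of_apply, bicontractSubst, Fin.succ_ne_zero, if_false, zero_ne_one, false_and,
        shiftDown_succ, shiftDown_zero, v]
    · have hsa : (1 : Fin (m + 2)).succAbove x.succ = x.succ.succ := by
        rw [← Fin.succ_zero_eq_one, Fin.succ_succAbove_succ, Fin.zero_succAbove]
      have hx1 : (x.succ.succ : Fin (m + 2)) ≠ 1 := by
        rw [Ne, succ_eq_one_iff]; exact Fin.succ_ne_zero _
      simp only [submatrix_apply, hsa, updateCol_apply, Fin.succ_ne_zero, if_false, hA, hN,
        of_apply, bicontractSubst, hx1, false_and, shiftDown_succ, mem_bicontractRowZero_iff,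
        false_and, or_false]
  -- column 0 of N is u + v
  have h3 : N.updateCol 0 (u + v) = N := by
    ext i' j'
    simp only [updateCol_apply]
    split_ifs with hj
    · subst hj
      simp only [hN, of_apply, mem_bicontractRowZero_iff, Fin.succ_zero_eq_one, true_and,
        Pi.add_apply, u, v]
      by_cases hP : (i'.succ, (1 : Fin (m + 2))) ∈ G <;>
        by_cases hQ : (i'.succ, (0 : Fin (m + 2))) ∈ G <;> simp [hP, hQ]
    · rfl
  -- Laplace expansion along row 0: only the columns 0 and 1 survive
  rw [Matrix.permanent_eq_sum_row_zero A, Fin.sum_univ_succ, Fin.sum_univ_succ]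
  have hvan : ∀ x : Fin m,
      A 0 x.succ.succ * permanent (A.submatrix Fin.succ x.succ.succ.succAbove) = 0 := by
    intro x
    have hx0 : (x.succ.succ : Fin (m + 2)) ≠ 0 := Fin.succ_ne_zero _
    have hx1 : (x.succ.succ : Fin (m + 2)) ≠ 1 := by
      rw [Ne, succ_eq_one_iff]; exact Fin.succ_ne_zero _
    rw [hrow, if_neg (not_or.2 ⟨hx0, hx1⟩), zero_mul]
  simp only [hvan, Finset.sum_const_zero, add_zero]
  rw [hrow 0, hrow (Fin.succ 0), if_pos (Or.inl rfl), if_pos (Or.inr Fin.succ_zero_eq_one), one_mul,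
    one_mul, Fin.succ_zero_eq_one, h1, h2, ← Matrix.permanent_updateCol_add, h3,
    perfectMatchingPoly_eq_permanent]

/-- **Bicontraction is a projection** (normal position): if the row vertex `0` of
`G ⊆ K_{m+2,m+2}` has degree two with neighbours the columns `0, 1`, then the perfect-matching
polynomial of the bicontraction `bicontractRowZero G` is a Valiant projection of `PM_G`.
[folklore] -/
theorem isProjection_perfectMatchingPoly_bicontractRowZero
    {G : Finset (Fin (m + 2) × Fin (m + 2))} (hG : RowZeroBicontractible G) :
    Literature.Computability.AlgebraicComplexity.IsProjection
      (perfectMatchingPoly (bicontractRowZero G) k) (perfectMatchingPoly G k) :=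
  ⟨bicontractSubst G, bicontractSubst_isVarOrConst G,
    (aeval_bicontractSubst_perfectMatchingPoly hG).symm⟩

end Bicontraction

end Literature.Combinatorics.SimpleGraph
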